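import Literature.Probability.LatticeModels.SRWHeatKernel1D
import Mathlib.Analysis.Complex.RealDeriv
import Mathlib.Analysis.Calculus.MeanValue
import Mathlib.Analysis.Real.Pi.Bounds
import HarnessLib

/-!
# The Gaussian-weighted local limit theorem for the continuous-time simple random walk on `ℤ`

Topic `Probability/LatticeModels`, continuation of `SRWHeatKernel1D.lean` (objects
`srwHeatKernel t m = q_t(m) = e^{-t}I_m(t)`, `gaussHeatKernel t m = φ_t(m) = (2πt)^{-1/2}e^{-m²/2t}`,
the entire integrand `srwHeatIntegrand t m z = e^{izm}e^{-t(1 - cos z)}` and its contour shift).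
PROVED here, by comparing the SHIFTED integrands `e^{i(k+iλ)m}e^{-t(1 - cos(k+iλ))}` and
`e^{i(k+iλ)m}e^{-t(k+iλ)²/2}` (the latter integrating over `ℝ` to `2πφ_t(m)` for every `λ`, an
instance of Mathlib's `integral_cexp_quadratic`):

* `norm_cexp_sub_cexp_le` (`|e^a - e^b| ≤ |a - b| e^{max(Re a, Re b)}`) and the Taylor bound
  `norm_cos_sub_le` (`|cos z - (1 - z²/2)| ≤ |z|⁴ e^{|z|}`);
* `srwHeatKernel_sub_gauss_core` : for `t ≥ 1`, `m ≥ 0`, `0 ≤ λ ≤ 1`,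
  `2π|q_t(m) - φ_t(m)| ≤ e^{-λm + (7/8)tλ²} (K₂ t^{-3/2} + K₃ λ⁴ t^{1/2})`;
* `srwHeatKernel_lclt` : **for every `p : ℕ` a constant `B` with
  `|q_t(m) - φ_t(m)| ≤ B t^{-3/2} (1 + m²/t)^{-p}` for all `t ≥ 1`, `m ∈ ℤ`** (`λ = |m|/t` in the
  Gaussian regime `|m| ≤ t`, `λ = 1` beyond).

This is the one-dimensional input of the Green-function asymptotics of
`LatticeGreenAsymptotics.lean` (Lawler–Limic 2010, Thm. 4.3.1); the `t^{-3/2}` (one order beyond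
the kernel size `t^{-1/2}`) with a Gaussian weight is exactly what sums to `O(|x|^{-d})` there.

## References

* G. F. Lawler, V. Limic, *Random Walk: A Modern Introduction*, CUP 2010, §2.3 and Thm. 4.3.1
  [LawlerLimic2010].
-/

noncomputable section

open MeasureTheory Set Filter intervalIntegral
open scoped Real Topology

namespace Literature.Probability.LatticeModels

/-! ### Two complex inequalities -/

/-- `‖e^a - e^b‖ ≤ ‖a - b‖ e^{max(Re a, Re b)}` (mean value theorem along the segment). [folklore] -/
theorem norm_cexp_sub_cexp_le (a b : ℂ) :
    ‖Complex.exp a - Complex.exp b‖ ≤ ‖a - b‖ * Real.exp (max a.re b.re) := by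
  set γ : ℝ → ℂ := fun s => Complex.exp (b + (s : ℂ) * (a - b)) with hγ
  have hderiv : ∀ s : ℝ, HasDerivAt γ (Complex.exp (b + (s : ℂ) * (a - b)) * (1 * (a - b))) s := by
    intro s
    have h1 : HasDerivAt (fun w : ℂ => Complex.exp (b + w * (a - b)))
        (Complex.exp (b + (s : ℂ) * (a - b)) * (1 * (a - b))) (s : ℂ) :=
      (((hasDerivAt_id (s : ℂ)).mul_const (a - b)).const_add b).cexp
    exact h1.comp_ofReal
  have hbound : ∀ s ∈ Ico (0 : ℝ) 1,
      ‖Complex.exp (b + (s : ℂ) * (a - b)) * (1 * (a - b))‖ ≤ ‖a - b‖ * Real.exp (max a.re b.re) := by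
    intro s hs
    rw [norm_mul, one_mul, Complex.norm_exp, mul_comm]
    refine mul_le_mul_of_nonneg_left (Real.exp_le_exp.2 ?_) (norm_nonneg _)
    have hre : (b + (s : ℂ) * (a - b)).re = b.re + s * (a.re - b.re) := by
      simp [Complex.mul_re]
    rw [hre]
    have h0 := hs.1
    have h1 := hs.2.le
    rcases le_total a.re b.re with hab | hab
    · rw [max_eq_right hab]; nlinarith
    · rw [max_eq_left hab]; nlinarith
  have h := norm_image_sub_le_of_norm_deriv_le_segment_01' (f := γ)
    (fun s _ => (hderiv s).hasDerivWithinAt) hbound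
  have h1 : γ 1 = Complex.exp a := by simp [hγ]
  have h0 : γ 0 = Complex.exp b := by simp [hγ]
  rwa [h1, h0] at h

/-- **Taylor bound for the complex cosine**: `‖cos z - (1 - z²/2)‖ ≤ ‖z‖⁴ e^{‖z‖}` (from
`‖e^w - Σ_{j<4} w^j/j!‖ ≤ ‖w‖⁴e^{‖w‖}` at `w = ±iz`). [folklore] -/
theorem norm_cos_sub_le (z : ℂ) :
    ‖Complex.cos z - (1 - z ^ 2 / 2)‖ ≤ ‖z‖ ^ 4 * Real.exp ‖z‖ := by
  have hs : ∀ w : ℂ, ∑ j ∈ Finset.range 4, w ^ j / (j.factorial : ℂ) =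
      1 + w + w ^ 2 / 2 + w ^ 3 / 6 := by
    intro w
    simp only [Finset.sum_range_succ, Finset.sum_range_zero, Nat.factorial, pow_zero, pow_one]
    push_cast
    ring
  have h1 := Complex.norm_exp_sub_sum_le_norm_mul_exp (z * Complex.I) 4
  have h2 := Complex.norm_exp_sub_sum_le_norm_mul_exp (-z * Complex.I) 4
  rw [hs] at h1 h2
  have hn1 : ‖z * Complex.I‖ = ‖z‖ := by simp
  have hn2 : ‖-z * Complex.I‖ = ‖z‖ := by simp
  rw [hn1] at h1
  rw [hn2] at h2
  have hI2 : Complex.I ^ 2 = -1 := Complex.I_sq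
  have hcos : Complex.cos z - (1 - z ^ 2 / 2) =
      ((Complex.exp (z * Complex.I) - (1 + z * Complex.I + (z * Complex.I) ^ 2 / 2 + (z * Complex.I) ^ 3 / 6)) +
        (Complex.exp (-z * Complex.I) -
          (1 + -z * Complex.I + (-z * Complex.I) ^ 2 / 2 + (-z * Complex.I) ^ 3 / 6))) / 2 := by
    have hc : Complex.cos z = (Complex.exp (z * Complex.I) + Complex.exp (-z * Complex.I)) / 2 := by
      rw [← Complex.two_cos]; ring
    linear_combination hc + (z ^ 2 / 2) * hI2
  rw [hcos, norm_div, Complex.norm_two]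
  calc ‖(Complex.exp (z * Complex.I) - (1 + z * Complex.I + (z * Complex.I) ^ 2 / 2 + (z * Complex.I) ^ 3 / 6)) +
        (Complex.exp (-z * Complex.I) -
          (1 + -z * Complex.I + (-z * Complex.I) ^ 2 / 2 + (-z * Complex.I) ^ 3 / 6))‖ / 2
      ≤ (‖z‖ ^ 4 * Real.exp ‖z‖ + ‖z‖ ^ 4 * Real.exp ‖z‖) / 2 := by
        gcongr
        exact (norm_add_le _ _).trans (add_le_add h1 h2)
    _ = ‖z‖ ^ 4 * Real.exp ‖z‖ := by ring

/-! ### The shifted Gaussian integrand -/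

/-- The Gaussian analogue `G_{t,m,λ}(k) = e^{i(k+iλ)m} e^{-t(k+iλ)²/2}` of the shifted integrand
(written out; no separate definition) is a quadratic exponential
`exp(-(t/2)k² + i(m - tλ)k + (tλ²/2 - λm))`. [folklore] -/
theorem gaussShift_eq (t : ℝ) (m : ℤ) (lam k : ℝ) :
    Complex.exp (Complex.I * ((k : ℂ) + lam * Complex.I) * m) *
        Complex.exp (-(t : ℂ) * ((k : ℂ) + lam * Complex.I) ^ 2 / 2) =
      Complex.exp (-((t : ℂ) / 2) * (k : ℂ) ^ 2 + (Complex.I * ((m : ℂ) - t * lam)) * k +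
        ((t * lam ^ 2 / 2 - lam * m : ℝ) : ℂ)) := by
  rw [← Complex.exp_add]
  congr 1
  have hI2 : Complex.I ^ 2 = -1 := Complex.I_sq
  push_cast
  ring_nf
  rw [hI2]
  ring

/-- **`∫_ℝ G_{t,m,λ}(k) dk = 2π φ_t(m)` for every `λ`** (`t > 0`), with integrability — Mathlib's
`integral_cexp_quadratic`. [folklore] -/
theorem integral_gaussShift {t : ℝ} (ht : 0 < t) (m : ℤ) (lam : ℝ) :
    Integrable (fun k : ℝ => Complex.exp (Complex.I * ((k : ℂ) + lam * Complex.I) * m) *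
        Complex.exp (-(t : ℂ) * ((k : ℂ) + lam * Complex.I) ^ 2 / 2)) ∧
      ∫ k : ℝ, Complex.exp (Complex.I * ((k : ℂ) + lam * Complex.I) * m) *
          Complex.exp (-(t : ℂ) * ((k : ℂ) + lam * Complex.I) ^ 2 / 2) =
        ((2 * π * gaussHeatKernel t m : ℝ) : ℂ) := by
  have hb : (-((t : ℂ) / 2)).re < 0 := by
    rw [Complex.neg_re, neg_lt_zero, show ((t : ℂ) / 2) = ((t / 2 : ℝ) : ℂ) by push_cast; ring,
      Complex.ofReal_re]
    positivity
  have hfun : (fun k : ℝ => Complex.exp (Complex.I * ((k : ℂ) + lam * Complex.I) * m) *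
      Complex.exp (-(t : ℂ) * ((k : ℂ) + lam * Complex.I) ^ 2 / 2)) = fun k : ℝ =>
      Complex.exp (-((t : ℂ) / 2) * (k : ℂ) ^ 2 + (Complex.I * ((m : ℂ) - t * lam)) * k +
        ((t * lam ^ 2 / 2 - lam * m : ℝ) : ℂ)) := funext fun k => gaussShift_eq t m lam k
  refine ⟨?_, ?_⟩
  · rw [hfun]; exact integrable_cexp_quadratic' hb _ _
  · rw [show (∫ k : ℝ, Complex.exp (Complex.I * ((k : ℂ) + lam * Complex.I) * m) *
        Complex.exp (-(t : ℂ) * ((k : ℂ) + lam * Complex.I) ^ 2 / 2)) = ∫ k : ℝ,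
        Complex.exp (-((t : ℂ) / 2) * (k : ℂ) ^ 2 + (Complex.I * ((m : ℂ) - t * lam)) * k +
          ((t * lam ^ 2 / 2 - lam * m : ℝ) : ℂ)) from integral_congr_ae (Eventually.of_forall fun k =>
        gaussShift_eq t m lam k), integral_cexp_quadratic hb]
    -- the constants
    have hI2 : Complex.I ^ 2 = -1 := Complex.I_sq
    have ht0 : (t : ℂ) ≠ 0 := by exact_mod_cast ht.ne'
    have hexp : ((t * lam ^ 2 / 2 - lam * m : ℝ) : ℂ) -
        (Complex.I * ((m : ℂ) - t * lam)) ^ 2 / (4 * -((t : ℂ) / 2)) = ((-((m : ℝ) ^ 2 / (2 * t)) : ℝ) : ℂ) := by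
      push_cast
      field_simp
      ring_nf
      rw [hI2]
      ring
    rw [hexp, show (π : ℂ) / - -((t : ℂ) / 2) = ((2 * π / t : ℝ) : ℂ) by push_cast; field_simp,
      show (1 / 2 : ℂ) = ((1 / 2 : ℝ) : ℂ) by push_cast; ring, ← Complex.ofReal_cpow (by positivity),
      ← Complex.ofReal_exp, ← Complex.ofReal_mul]
    congr 1
    unfold gaussHeatKernel
    rw [← Real.sqrt_eq_rpow]
    have h2 : Real.sqrt (2 * π * t) = Real.sqrt (2 * π) * Real.sqrt t := Real.sqrt_mul (by positivity) t
    have h3 : Real.sqrt (2 * π / t) = Real.sqrt (2 * π) / Real.sqrt t := Real.sqrt_div (by positivity) t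
    have h5 : 0 < Real.sqrt t := Real.sqrt_pos.2 ht
    have h6 : 0 < Real.sqrt (2 * π) := Real.sqrt_pos.2 (by positivity)
    rw [h2, h3]
    field_simp
    rw [Real.sq_sqrt (by positivity)]

/-- `‖G_{t,m,λ}(k)‖ = e^{-λm} e^{-t(k² - λ²)/2}`. [folklore] -/
theorem norm_gaussShift (t : ℝ) (m : ℤ) (lam k : ℝ) :
    ‖Complex.exp (Complex.I * ((k : ℂ) + lam * Complex.I) * m) *
        Complex.exp (-(t : ℂ) * ((k : ℂ) + lam * Complex.I) ^ 2 / 2)‖ =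
      Real.exp (-(lam * m)) * Real.exp (-(t * (k ^ 2 - lam ^ 2) / 2)) := by
  rw [norm_mul, Complex.norm_exp, Complex.norm_exp]
  have hI2 : Complex.I ^ 2 = -1 := Complex.I_sq
  congr 2
  · simp [Complex.mul_re, Complex.mul_im]
  · have : -(t : ℂ) * ((k : ℂ) + lam * Complex.I) ^ 2 / 2 =
        ((-(t * (k ^ 2 - lam ^ 2) / 2) : ℝ) : ℂ) + ((-(t * k * lam) : ℝ) : ℂ) * Complex.I := by
      push_cast
      ring_nf
      rw [hI2]
      ring
    rw [this, Complex.add_re, Complex.ofReal_re, Complex.re_ofReal_mul, Complex.I_re, mul_zero, add_zero]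

/-! ### Pointwise comparison of the two shifted integrands -/

/-- The shifted random-walk integrand factorised like the Gaussian one:
`F_{t,m}(k + iλ) = e^{i(k+iλ)m} e^{-t(1 - cos(k+iλ))}`. [folklore] -/
theorem srwHeatIntegrand_shift_eq (t : ℝ) (m : ℤ) (lam k : ℝ) :
    srwHeatIntegrand t m ((k : ℂ) + lam * Complex.I) =
      Complex.exp (Complex.I * ((k : ℂ) + lam * Complex.I) * m) *
        Complex.exp (-(t : ℂ) * (1 - Complex.cos ((k : ℂ) + lam * Complex.I))) := rfl

/-- The common upper bound of the real parts of the two exponents: for `t ≥ 0`, `|k| ≤ π`,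
`|λ| ≤ 1`: `Re(-t(1 - cos(k+iλ))) ≤ -(2t/π²)k² + (7/8)tλ²`. [folklore] -/
theorem re_exponent_srw_le {t k lam : ℝ} (ht : 0 ≤ t) (hk : |k| ≤ π) (hl : |lam| ≤ 1) :
    (-(t : ℂ) * (1 - Complex.cos ((k : ℂ) + lam * Complex.I))).re ≤
      -(2 * t / π ^ 2) * k ^ 2 + 7 / 8 * t * lam ^ 2 := by
  have h := one_sub_cos_add_mul_I_re k lam
  have hre : (-(t : ℂ) * (1 - Complex.cos ((k : ℂ) + lam * Complex.I))).re =
      -(t * (1 - Real.cos k * Real.cosh lam)) := by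
    rw [Complex.mul_re, h]
    simp
  rw [hre]
  have hc := cosh_sub_one_le hl
  have h1 : 1 ≤ Real.cosh lam := Real.one_le_cosh lam
  have h2 : 0 ≤ 1 - Real.cos k := sub_nonneg.2 (Real.cos_le_one k)
  have hj := Real.cos_le_one_sub_mul_cos_sq hk
  -- `-t(1 - cos k cosh λ) = -t cosh λ (1 - cos k) + t (cosh λ - 1)`
  have e : -(t * (1 - Real.cos k * Real.cosh lam)) =
      -(t * Real.cosh lam * (1 - Real.cos k)) + t * (Real.cosh lam - 1) := by ring
  rw [e]
  have h3 : t * (1 - Real.cos k) ≤ t * Real.cosh lam * (1 - Real.cos k) := by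
    have := mul_le_mul_of_nonneg_left h1 (mul_nonneg ht h2)
    nlinarith
  have h4 : t * (2 / π ^ 2 * k ^ 2) ≤ t * (1 - Real.cos k) :=
    mul_le_mul_of_nonneg_left (by linarith) ht
  have h5 : t * (Real.cosh lam - 1) ≤ t * (7 / 8 * lam ^ 2) := mul_le_mul_of_nonneg_left hc ht
  have e2 : t * (2 / π ^ 2 * k ^ 2) = 2 * t / π ^ 2 * k ^ 2 := by ring
  linarith

/-- The Gaussian exponent: `Re(-t(k+iλ)²/2) = -t(k² - λ²)/2 ≤ -(2t/π²)k² + (7/8)tλ²` (`t ≥ 0`).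
[folklore] -/
theorem re_exponent_gauss_le {t : ℝ} (ht : 0 ≤ t) (k lam : ℝ) :
    (-(t : ℂ) * ((k : ℂ) + lam * Complex.I) ^ 2 / 2).re ≤ -(2 * t / π ^ 2) * k ^ 2 + 7 / 8 * t * lam ^ 2 := by
  have hI2 : Complex.I ^ 2 = -1 := Complex.I_sq
  have : -(t : ℂ) * ((k : ℂ) + lam * Complex.I) ^ 2 / 2 =
      ((-(t * (k ^ 2 - lam ^ 2) / 2) : ℝ) : ℂ) + ((-(t * k * lam) : ℝ) : ℂ) * Complex.I := by
    push_cast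
    ring_nf
    rw [hI2]
    ring
  rw [this, Complex.add_re, Complex.ofReal_re, Complex.re_ofReal_mul, Complex.I_re, mul_zero, add_zero]
  have hπ : (4 : ℝ) ≤ π ^ 2 := by nlinarith [Real.pi_gt_three]
  have h1 : 2 * t / π ^ 2 * k ^ 2 ≤ t * k ^ 2 / 2 := by
    rw [div_mul_eq_mul_div, div_le_iff₀ (by positivity)]
    nlinarith [mul_nonneg ht (sq_nonneg k)]
  nlinarith [mul_nonneg ht (sq_nonneg lam)]

/-- `(|k| + |λ|)⁴ ≤ 8(k⁴ + λ⁴)`. [folklore] -/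
theorem abs_add_abs_pow_four_le (k lam : ℝ) : (|k| + |lam|) ^ 4 ≤ 8 * (k ^ 4 + lam ^ 4) := by
  have h1 : (|k| + |lam|) ^ 2 ≤ 2 * (k ^ 2 + lam ^ 2) := by
    have : 0 ≤ (|k| - |lam|) ^ 2 := sq_nonneg _
    nlinarith [sq_abs k, sq_abs lam]
  have h2 : (k ^ 2 + lam ^ 2) ^ 2 ≤ 2 * (k ^ 4 + lam ^ 4) := by nlinarith [sq_nonneg (k ^ 2 - lam ^ 2)]
  calc (|k| + |lam|) ^ 4 = ((|k| + |lam|) ^ 2) ^ 2 := by ring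
    _ ≤ (2 * (k ^ 2 + lam ^ 2)) ^ 2 := pow_le_pow_left₀ (by positivity) h1 2
    _ = 4 * (k ^ 2 + lam ^ 2) ^ 2 := by ring
    _ ≤ 8 * (k ^ 4 + lam ^ 4) := by nlinarith

/-- **Pointwise comparison**: for `t ≥ 0`, `|k| ≤ π`, `|λ| ≤ 1`,
`‖F_{t,m}(k+iλ) - G_{t,m,λ}(k)‖ ≤ e^{-λm} · 8e⁵ t (k⁴ + λ⁴) · e^{-(2t/π²)k² + (7/8)tλ²}`
(`|e^a - e^b| ≤ |a-b|e^{max Re}`, `|a - b| = t|cos z - 1 + z²/2| ≤ t|z|⁴e^{|z|}`, `|z| ≤ π + 1 ≤ 5`).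
[folklore] -/
theorem norm_srwHeatIntegrand_sub_gauss_le {t k lam : ℝ} (ht : 0 ≤ t) (hk : |k| ≤ π) (hl : |lam| ≤ 1)
    (m : ℤ) :
    ‖srwHeatIntegrand t m ((k : ℂ) + lam * Complex.I) -
        Complex.exp (Complex.I * ((k : ℂ) + lam * Complex.I) * m) *
          Complex.exp (-(t : ℂ) * ((k : ℂ) + lam * Complex.I) ^ 2 / 2)‖ ≤
      Real.exp (-(lam * m)) * (8 * Real.exp 5 * t * (k ^ 4 + lam ^ 4)) *
        Real.exp (-(2 * t / π ^ 2) * k ^ 2 + 7 / 8 * t * lam ^ 2) := by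
  set z : ℂ := (k : ℂ) + lam * Complex.I with hz
  set a : ℂ := -(t : ℂ) * (1 - Complex.cos z) with ha
  set b : ℂ := -(t : ℂ) * z ^ 2 / 2 with hb
  have hfac : srwHeatIntegrand t m z -
      Complex.exp (Complex.I * ((k : ℂ) + lam * Complex.I) * m) *
        Complex.exp (-(t : ℂ) * ((k : ℂ) + lam * Complex.I) ^ 2 / 2) =
      Complex.exp (Complex.I * z * m) * (Complex.exp a - Complex.exp b) := by
    simp only [hz, ha, hb, srwHeatIntegrand]
    ring
  rw [hfac, norm_mul, Complex.norm_exp]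
  have hre1 : (Complex.I * z * m).re = -(lam * m) := by
    simp [hz, Complex.mul_re, Complex.mul_im]
  rw [hre1, mul_assoc]
  refine mul_le_mul_of_nonneg_left ?_ (Real.exp_pos _).le
  -- `‖e^a - e^b‖ ≤ ‖a - b‖ e^{max}`
  have h1 := norm_cexp_sub_cexp_le a b
  have hmax : max a.re b.re ≤ -(2 * t / π ^ 2) * k ^ 2 + 7 / 8 * t * lam ^ 2 :=
    max_le (re_exponent_srw_le ht hk hl) (re_exponent_gauss_le ht k lam)
  have hab : a - b = (t : ℂ) * (Complex.cos z - (1 - z ^ 2 / 2)) := by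
    rw [ha, hb]; ring
  have hznorm : ‖z‖ ≤ 5 := by
    calc ‖z‖ ≤ ‖(k : ℂ)‖ + ‖(lam : ℂ) * Complex.I‖ := norm_add_le _ _
      _ = |k| + |lam| := by simp
      _ ≤ π + 1 := add_le_add hk hl
      _ ≤ 5 := by linarith [Real.pi_le_four]
  have hz4 : ‖z‖ ^ 4 ≤ 8 * (k ^ 4 + lam ^ 4) := by
    have : ‖z‖ ≤ |k| + |lam| := by
      calc ‖z‖ ≤ ‖(k : ℂ)‖ + ‖(lam : ℂ) * Complex.I‖ := norm_add_le _ _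
        _ = |k| + |lam| := by simp
    exact (pow_le_pow_left₀ (norm_nonneg _) this 4).trans (abs_add_abs_pow_four_le k lam)
  have hnab : ‖a - b‖ ≤ 8 * Real.exp 5 * t * (k ^ 4 + lam ^ 4) := by
    rw [hab, norm_mul, Complex.norm_real, Real.norm_eq_abs, abs_of_nonneg ht]
    calc t * ‖Complex.cos z - (1 - z ^ 2 / 2)‖ ≤ t * (‖z‖ ^ 4 * Real.exp ‖z‖) :=
          mul_le_mul_of_nonneg_left (norm_cos_sub_le z) ht
      _ ≤ t * (8 * (k ^ 4 + lam ^ 4) * Real.exp 5) := by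
          gcongr
      _ = 8 * Real.exp 5 * t * (k ^ 4 + lam ^ 4) := by ring
  calc ‖Complex.exp a - Complex.exp b‖ ≤ ‖a - b‖ * Real.exp (max a.re b.re) := h1
    _ ≤ 8 * Real.exp 5 * t * (k ^ 4 + lam ^ 4) * Real.exp (-(2 * t / π ^ 2) * k ^ 2 + 7 / 8 * t * lam ^ 2) := by
        gcongr

/-- **Gaussian tail**: for `t ≥ 0` and `π ≤ |k|`,
`‖G_{t,m,λ}(k)‖ ≤ e^{-λm + tλ²/2} e^{-π²t/4} e^{-(t/4)k²}`. [folklore] -/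
theorem norm_gaussShift_le_tail {t k : ℝ} (ht : 0 ≤ t) (hk : π ≤ |k|) (m : ℤ) (lam : ℝ) :
    ‖Complex.exp (Complex.I * ((k : ℂ) + lam * Complex.I) * m) *
        Complex.exp (-(t : ℂ) * ((k : ℂ) + lam * Complex.I) ^ 2 / 2)‖ ≤
      Real.exp (-(lam * m) + t * lam ^ 2 / 2) * Real.exp (-(π ^ 2 * t / 4)) * Real.exp (-(t / 4) * k ^ 2) := by
  rw [norm_gaussShift, ← Real.exp_add, ← Real.exp_add, ← Real.exp_add, Real.exp_le_exp]
  have hk2 : π ^ 2 ≤ k ^ 2 := by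
    calc π ^ 2 ≤ |k| ^ 2 := pow_le_pow_left₀ Real.pi_pos.le hk 2
      _ = k ^ 2 := sq_abs k
  nlinarith [mul_le_mul_of_nonneg_left hk2 ht]

/-! ### Gaussian integrals -/

/-- `k⁴ e^{-αk²} ≤ 8α⁻² e^{-(α/2)k²}` for `α > 0` (from `y²/2 ≤ e^y` at `y = αk²/2`). [folklore] -/
theorem pow_four_mul_exp_neg_le {α : ℝ} (hα : 0 < α) (k : ℝ) :
    k ^ 4 * Real.exp (-α * k ^ 2) ≤ 8 * α⁻¹ ^ 2 * Real.exp (-(α / 2) * k ^ 2) := by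
  have hy : 0 ≤ α * k ^ 2 / 2 := by positivity
  have h := Real.pow_div_factorial_le_exp (hx := hy) (n := 2)
  norm_num [Nat.factorial] at h
  -- `h : (α k²/2)²/2 ≤ e^{αk²/2}`
  have e1 : Real.exp (-α * k ^ 2) = Real.exp (-(α / 2) * k ^ 2) * Real.exp (-(α * k ^ 2 / 2)) := by
    rw [← Real.exp_add]; congr 1; ring
  have e2 : Real.exp (α * k ^ 2 / 2) * Real.exp (-(α * k ^ 2 / 2)) = 1 := by
    rw [← Real.exp_add]; simp
  have hk4 : k ^ 4 ≤ 8 * α⁻¹ ^ 2 * Real.exp (α * k ^ 2 / 2) := by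
    have hα2 : 0 < α ^ 2 := by positivity
    have : α ^ 2 * k ^ 4 ≤ 8 * Real.exp (α * k ^ 2 / 2) := by nlinarith
    calc k ^ 4 = α⁻¹ ^ 2 * (α ^ 2 * k ^ 4) := by field_simp
      _ ≤ α⁻¹ ^ 2 * (8 * Real.exp (α * k ^ 2 / 2)) := by gcongr
      _ = 8 * α⁻¹ ^ 2 * Real.exp (α * k ^ 2 / 2) := by ring
  rw [e1]
  calc k ^ 4 * (Real.exp (-(α / 2) * k ^ 2) * Real.exp (-(α * k ^ 2 / 2)))
      ≤ 8 * α⁻¹ ^ 2 * Real.exp (α * k ^ 2 / 2) * (Real.exp (-(α / 2) * k ^ 2) * Real.exp (-(α * k ^ 2 / 2))) := by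
        gcongr
    _ = 8 * α⁻¹ ^ 2 * Real.exp (-(α / 2) * k ^ 2) * (Real.exp (α * k ^ 2 / 2) * Real.exp (-(α * k ^ 2 / 2))) := by
        ring
    _ = 8 * α⁻¹ ^ 2 * Real.exp (-(α / 2) * k ^ 2) := by rw [e2, mul_one]

/-- `√(π/β) ≤ π² √(1/t)`-type evaluation: `∫_ℝ e^{-(t/π²)k²} dk = √(π³/t) ≤ π² t^{-1/2}` for `t > 0`.
[folklore] -/
theorem integral_exp_neg_div_pi_sq_le {t : ℝ} (ht : 0 < t) :
    ∫ k, Real.exp (-(t / π ^ 2) * k ^ 2) ≤ π ^ 2 * t ^ (-(1 / 2 : ℝ)) := by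
  rw [integral_gaussian]
  have hπ := Real.pi_pos
  have e : π / (t / π ^ 2) = π ^ 3 * t⁻¹ := by field_simp
  rw [e, Real.sqrt_mul (by positivity), Real.sqrt_inv, Real.rpow_neg ht.le, ← Real.sqrt_eq_rpow]
  refine mul_le_mul_of_nonneg_right ?_ (by positivity)
  rw [Real.sqrt_le_left (by positivity)]
  have h3 : 3 < π := Real.pi_gt_three
  calc π ^ 3 = π ^ 3 * 1 := by ring
    _ ≤ π ^ 3 * π := by gcongr; linarith
    _ = (π ^ 2) ^ 2 := by ring

/-- The tail Gaussian: `e^{-π²t/4} ∫_ℝ e^{-(t/4)k²} dk ≤ 2 t^{-3/2}` for `t > 0`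
(`e^{-u} ≤ 1/u`, `∫ e^{-(t/4)k²} = 2√(π/t)`, `8√π ≤ 2π²`). [folklore] -/
theorem exp_mul_integral_tail_le {t : ℝ} (ht : 0 < t) :
    Real.exp (-(π ^ 2 * t / 4)) * ∫ k, Real.exp (-(t / 4) * k ^ 2) ≤ 2 * t ^ (-(3 / 2 : ℝ)) := by
  rw [integral_gaussian]
  have hπ := Real.pi_pos
  have hπ3 := Real.pi_gt_three
  -- `e^{-u} ≤ 1/u`
  have hu : 0 < π ^ 2 * t / 4 := by positivity
  have hexp : Real.exp (-(π ^ 2 * t / 4)) ≤ (π ^ 2 * t / 4)⁻¹ := by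
    have h1 : π ^ 2 * t / 4 + 1 ≤ Real.exp (π ^ 2 * t / 4) := Real.add_one_le_exp _
    rw [Real.exp_neg, inv_le_inv₀ (Real.exp_pos _) hu]
    linarith
  have hsqrt : Real.sqrt (π / (t / 4)) = 2 * Real.sqrt π * t ^ (-(1 / 2 : ℝ)) := by
    rw [show π / (t / 4) = 2 ^ 2 * π * t⁻¹ by field_simp; ring, Real.sqrt_mul (by positivity),
      Real.sqrt_mul (by positivity), Real.sqrt_sq (by norm_num), Real.sqrt_inv, Real.rpow_neg ht.le,
      ← Real.sqrt_eq_rpow]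
  rw [hsqrt]
  have hsπ : Real.sqrt π ≤ 2 := by
    rw [Real.sqrt_le_left (by norm_num)]; linarith [Real.pi_le_four]
  have ht32 : t ^ (-(3 / 2 : ℝ)) = t⁻¹ * t ^ (-(1 / 2 : ℝ)) := by
    rw [show (-(3 / 2 : ℝ)) = -1 + -(1 / 2 : ℝ) by norm_num, Real.rpow_add ht, Real.rpow_neg_one]
  rw [ht32]
  have hpow : 0 ≤ t ^ (-(1 / 2 : ℝ)) := Real.rpow_nonneg ht.le _
  calc Real.exp (-(π ^ 2 * t / 4)) * (2 * Real.sqrt π * t ^ (-(1 / 2 : ℝ)))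
      ≤ (π ^ 2 * t / 4)⁻¹ * (2 * 2 * t ^ (-(1 / 2 : ℝ))) := by
        gcongr
    _ = (16 / π ^ 2) * (t⁻¹ * t ^ (-(1 / 2 : ℝ))) := by field_simp; ring
    _ ≤ 2 * (t⁻¹ * t ^ (-(1 / 2 : ℝ))) := by
        refine mul_le_mul_of_nonneg_right ?_ (by positivity)
        rw [div_le_iff₀ (by positivity)]; nlinarith

/-! ### The core estimate -/

/-- Powers of `t`: `t · t⁻² · t^{-1/2} = t^{-3/2}` and `t · t^{-1/2} = t^{1/2}` (`t > 0`). [folklore] -/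
theorem rpow_bookkeeping {t : ℝ} (ht : 0 < t) :
    t * t⁻¹ ^ 2 * t ^ (-(1 / 2 : ℝ)) = t ^ (-(3 / 2 : ℝ)) ∧ t * t ^ (-(1 / 2 : ℝ)) = t ^ (1 / 2 : ℝ) ∧
      t ^ (-(3 / 2 : ℝ)) = t⁻¹ * t ^ (-(1 / 2 : ℝ)) := by
  have h3 : t ^ (-(3 / 2 : ℝ)) = t⁻¹ * t ^ (-(1 / 2 : ℝ)) := by
    rw [show (-(3 / 2 : ℝ)) = -1 + -(1 / 2 : ℝ) by norm_num, Real.rpow_add ht, Real.rpow_neg_one]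
  refine ⟨?_, ?_, h3⟩
  · rw [h3]; field_simp
  · conv_rhs => rw [show (1 / 2 : ℝ) = 1 + -(1 / 2 : ℝ) by norm_num, Real.rpow_add ht, Real.rpow_one]

/-- **The core comparison**: for `t ≥ 1`, `m ∈ ℤ` and a shift `0 ≤ λ ≤ 1`,
`2π |q_t(m) - φ_t(m)| ≤ e^{-λm + (7/8)tλ²} ((16e⁵π⁶ + 2) t^{-3/2} + 8e⁵π² λ⁴ t^{1/2})`:
`2π(q - φ) = ∫_{(-π,π]} (F(k+iλ) - G_λ(k)) dk - ∫_{|k| ≥ π} G_λ(k) dk`, the first integrand bounded by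
`norm_srwHeatIntegrand_sub_gauss_le` and `k⁴e^{-αk²} ≤ 8α⁻²e^{-αk²/2}`, the second by the Gaussian
tail `norm_gaussShift_le_tail`. [folklore] -/
theorem srwHeatKernel_sub_gauss_core {t : ℝ} (ht : 1 ≤ t) (m : ℤ) {lam : ℝ} (hl0 : 0 ≤ lam)
    (hl1 : lam ≤ 1) :
    2 * π * |srwHeatKernel t m - gaussHeatKernel t m| ≤
      Real.exp (-(lam * m) + 7 / 8 * t * lam ^ 2) *
        ((16 * Real.exp 5 * π ^ 6 + 2) * t ^ (-(3 / 2 : ℝ)) +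
          8 * Real.exp 5 * π ^ 2 * lam ^ 4 * t ^ (1 / 2 : ℝ)) := by
  have ht0 : 0 < t := by linarith
  have hπ := Real.pi_pos
  have hle : (-π : ℝ) ≤ π := by linarith
  have hl : |lam| ≤ 1 := abs_le.2 ⟨by linarith, hl1⟩
  set s : Set ℝ := Ioc (-π) π with hs_def
  have hs : MeasurableSet s := measurableSet_Ioc
  set F : ℝ → ℂ := fun k => srwHeatIntegrand t m ((k : ℂ) + lam * Complex.I) with hF
  set G : ℝ → ℂ := fun k => Complex.exp (Complex.I * ((k : ℂ) + lam * Complex.I) * m) *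
    Complex.exp (-(t : ℂ) * ((k : ℂ) + lam * Complex.I) ^ 2 / 2) with hG
  obtain ⟨hGint, hGval⟩ := integral_gaussShift ht0 m lam
  have hFcont : Continuous F := (differentiable_srwHeatIntegrand t m).continuous.comp (by fun_prop)
  -- the two representations
  have hq : ((2 * π * srwHeatKernel t m : ℝ) : ℂ) = ∫ k in s, F k := by
    rw [← integral_srwHeatIntegrand, integral_srwHeatIntegrand_shift t m lam,
      intervalIntegral.integral_of_le hle]
  have hφ : ((2 * π * gaussHeatKernel t m : ℝ) : ℂ) = (∫ k in s, G k) + ∫ k in sᶜ, G k := by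
    rw [integral_add_compl hs hGint]; exact hGval.symm
  have hFi : IntegrableOn F s := (hFcont.integrableOn_Icc (a := -π) (b := π)).mono_set Ioc_subset_Icc_self
  have hGi : IntegrableOn G s := hGint.integrableOn
  have hdiff : ((2 * π * (srwHeatKernel t m - gaussHeatKernel t m) : ℝ) : ℂ) =
      (∫ k in s, (F k - G k)) - ∫ k in sᶜ, G k := by
    rw [mul_sub, Complex.ofReal_sub, hq, hφ, integral_sub hFi hGi]
    ring
  have h2π : (0 : ℝ) < 2 * π := by positivity
  have hnorm : ‖((2 * π * (srwHeatKernel t m - gaussHeatKernel t m) : ℝ) : ℂ)‖ =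
      2 * π * |srwHeatKernel t m - gaussHeatKernel t m| := by
    rw [Complex.norm_real, Real.norm_eq_abs, abs_mul, abs_of_pos h2π]
  rw [← hnorm, hdiff]
  -- the dominating functions
  set E : ℝ := Real.exp (-(lam * m) + 7 / 8 * t * lam ^ 2) with hE
  have hE0 : 0 < E := Real.exp_pos _
  set C₁ : ℝ := E * (8 * Real.exp 5 * t * (2 * π ^ 4 * t⁻¹ ^ 2 + lam ^ 4)) with hC₁
  have hC₁0 : 0 ≤ C₁ := by positivity
  set b₁ : ℝ → ℝ := fun k => C₁ * Real.exp (-(t / π ^ 2) * k ^ 2) with hb₁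
  set C₂ : ℝ := Real.exp (-(lam * m) + t * lam ^ 2 / 2) * Real.exp (-(π ^ 2 * t / 4)) with hC₂
  have hC₂0 : 0 ≤ C₂ := by positivity
  set b₂ : ℝ → ℝ := fun k => C₂ * Real.exp (-(t / 4) * k ^ 2) with hb₂
  have hg₁ := integrable_exp_neg_mul_sq (show 0 < t / π ^ 2 by positivity)
  have hg₂ := integrable_exp_neg_mul_sq (show 0 < t / 4 by positivity)
  have hb₁i : Integrable b₁ := hg₁.const_mul C₁
  have hb₂i : Integrable b₂ := hg₂.const_mul C₂
  -- pointwise bound on `(-π, π]`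
  have h1 : ∀ k ∈ s, ‖F k - G k‖ ≤ b₁ k := by
    intro k hk
    have hkπ : |k| ≤ π := abs_le.2 ⟨hk.1.le, hk.2⟩
    refine (norm_srwHeatIntegrand_sub_gauss_le ht0.le hkπ hl m).trans ?_
    have hα : (0 : ℝ) < 2 * t / π ^ 2 := by positivity
    have hk4 := pow_four_mul_exp_neg_le hα k
    have eα1 : (8 : ℝ) * (2 * t / π ^ 2)⁻¹ ^ 2 = 2 * π ^ 4 * t⁻¹ ^ 2 := by field_simp; ring
    have eα2 : -(2 * t / π ^ 2 / 2) * k ^ 2 = -(t / π ^ 2) * k ^ 2 := by ring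
    rw [eα1, eα2] at hk4
    have hmono : Real.exp (-(2 * t / π ^ 2) * k ^ 2) ≤ Real.exp (-(t / π ^ 2) * k ^ 2) := by
      rw [Real.exp_le_exp]; nlinarith [mul_nonneg ht0.le (sq_nonneg k), sq_nonneg π]
    have hkey : (k ^ 4 + lam ^ 4) * Real.exp (-(2 * t / π ^ 2) * k ^ 2) ≤
        (2 * π ^ 4 * t⁻¹ ^ 2 + lam ^ 4) * Real.exp (-(t / π ^ 2) * k ^ 2) := by
      have : lam ^ 4 * Real.exp (-(2 * t / π ^ 2) * k ^ 2) ≤ lam ^ 4 * Real.exp (-(t / π ^ 2) * k ^ 2) :=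
        mul_le_mul_of_nonneg_left hmono (by positivity)
      nlinarith
    rw [Real.exp_add]
    calc Real.exp (-(lam * m)) * (8 * Real.exp 5 * t * (k ^ 4 + lam ^ 4)) *
          (Real.exp (-(2 * t / π ^ 2) * k ^ 2) * Real.exp (7 / 8 * t * lam ^ 2))
        = (Real.exp (-(lam * m)) * Real.exp (7 / 8 * t * lam ^ 2)) * (8 * Real.exp 5 * t) *
            ((k ^ 4 + lam ^ 4) * Real.exp (-(2 * t / π ^ 2) * k ^ 2)) := by ring
      _ ≤ (Real.exp (-(lam * m)) * Real.exp (7 / 8 * t * lam ^ 2)) * (8 * Real.exp 5 * t) *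
            ((2 * π ^ 4 * t⁻¹ ^ 2 + lam ^ 4) * Real.exp (-(t / π ^ 2) * k ^ 2)) := by
          gcongr
      _ = b₁ k := by
          simp only [hb₁, hC₁, hE, Real.exp_add]; ring
  -- pointwise bound on the tail
  have h2 : ∀ k ∈ sᶜ, ‖G k‖ ≤ b₂ k := by
    intro k hk
    have hk' : π ≤ |k| := by
      simp only [hs_def, mem_compl_iff, mem_Ioc, not_and_or, not_lt, not_le] at hk
      rcases hk with hk | hk
      · rw [abs_of_nonpos (by linarith)]; linarith
      · rw [abs_of_pos (by linarith)]; linarith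
    have := norm_gaussShift_le_tail ht0.le hk' m lam
    simpa only [hb₂, hC₂] using this
  -- the two integral bounds
  have hpow := rpow_bookkeeping ht0
  have hI1 : ‖∫ k in s, (F k - G k)‖ ≤ C₁ * (π ^ 2 * t ^ (-(1 / 2 : ℝ))) := by
    calc ‖∫ k in s, (F k - G k)‖ ≤ ∫ k in s, ‖F k - G k‖ := norm_integral_le_integral_norm _
      _ ≤ ∫ k in s, b₁ k := setIntegral_mono_on (hFi.sub hGi).norm hb₁i.integrableOn hs h1
      _ ≤ ∫ k, b₁ k := setIntegral_le_integral hb₁i (Eventually.of_forall fun k => by positivity)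
      _ = C₁ * ∫ k, Real.exp (-(t / π ^ 2) * k ^ 2) := integral_const_mul _ _
      _ ≤ C₁ * (π ^ 2 * t ^ (-(1 / 2 : ℝ))) :=
          mul_le_mul_of_nonneg_left (integral_exp_neg_div_pi_sq_le ht0) hC₁0
  have hI2 : ‖∫ k in sᶜ, G k‖ ≤ Real.exp (-(lam * m) + t * lam ^ 2 / 2) * (2 * t ^ (-(3 / 2 : ℝ))) := by
    calc ‖∫ k in sᶜ, G k‖ ≤ ∫ k in sᶜ, ‖G k‖ := norm_integral_le_integral_norm _
      _ ≤ ∫ k in sᶜ, b₂ k := setIntegral_mono_on hGint.norm.integrableOn hb₂i.integrableOn hs.compl h2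
      _ ≤ ∫ k, b₂ k := setIntegral_le_integral hb₂i (Eventually.of_forall fun k => by positivity)
      _ = C₂ * ∫ k, Real.exp (-(t / 4) * k ^ 2) := integral_const_mul _ _
      _ = Real.exp (-(lam * m) + t * lam ^ 2 / 2) *
            (Real.exp (-(π ^ 2 * t / 4)) * ∫ k, Real.exp (-(t / 4) * k ^ 2)) := by rw [hC₂]; ring
      _ ≤ Real.exp (-(lam * m) + t * lam ^ 2 / 2) * (2 * t ^ (-(3 / 2 : ℝ))) :=
          mul_le_mul_of_nonneg_left (exp_mul_integral_tail_le ht0) (Real.exp_pos _).le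
  -- `e^{-λm + tλ²/2} ≤ E`
  have hE2 : Real.exp (-(lam * m) + t * lam ^ 2 / 2) ≤ E := by
    rw [hE, Real.exp_le_exp]; nlinarith [mul_nonneg ht0.le (sq_nonneg lam)]
  obtain ⟨hp1, hp2, -⟩ := hpow
  have ht32 : 0 < t ^ (-(3 / 2 : ℝ)) := Real.rpow_pos_of_pos ht0 _
  calc ‖(∫ k in s, (F k - G k)) - ∫ k in sᶜ, G k‖
      ≤ ‖∫ k in s, (F k - G k)‖ + ‖∫ k in sᶜ, G k‖ := norm_sub_le _ _
    _ ≤ C₁ * (π ^ 2 * t ^ (-(1 / 2 : ℝ))) + Real.exp (-(lam * m) + t * lam ^ 2 / 2) * (2 * t ^ (-(3 / 2 : ℝ))) :=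
        add_le_add hI1 hI2
    _ ≤ C₁ * (π ^ 2 * t ^ (-(1 / 2 : ℝ))) + E * (2 * t ^ (-(3 / 2 : ℝ))) := by
        gcongr
    _ = E * ((16 * Real.exp 5 * π ^ 6 + 2) * t ^ (-(3 / 2 : ℝ)) +
          8 * Real.exp 5 * π ^ 2 * lam ^ 4 * t ^ (1 / 2 : ℝ)) := by
        rw [hC₁, ← hp1, ← hp2]; ring

/-! ### The local limit theorem with Gaussian weights -/

/-- The Gaussian regime `0 ≤ m ≤ t` (`λ = m/t`): `2π|q_t(m) - φ_t(m)|(1 + m²/t)^p ≤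
K 8^{p+2}(p+2)! e^{1/8} t^{-3/2}` for `t ≥ 1`. [folklore] -/
theorem lclt_gaussian_regime (p : ℕ) {t : ℝ} (ht : 1 ≤ t) {m : ℤ} (hm : 0 ≤ m) (hmt : (m : ℝ) ≤ t) :
    2 * π * |srwHeatKernel t m - gaussHeatKernel t m| * (1 + (m : ℝ) ^ 2 / t) ^ p ≤
      (16 * Real.exp 5 * π ^ 6 + 2 + 8 * Real.exp 5 * π ^ 2) *
        (8 ^ (p + 2) * (p + 2).factorial * Real.exp (1 / 8)) * t ^ (-(3 / 2 : ℝ)) := by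
  set K : ℝ := (16 * Real.exp 5 * π ^ 6 + 2 + 8 * Real.exp 5 * π ^ 2) with hKdef
  have ht0 : 0 < t := by linarith
  have hK : 0 < K := by rw [hKdef]; positivity
  have hm0 : (0 : ℝ) ≤ m := by exact_mod_cast hm
  set u : ℝ := (m : ℝ) ^ 2 / t with hu
  have hu0 : 0 ≤ u := by positivity
  have hw : 0 < (1 + u) ^ p := by positivity
  have ht32 : 0 < t ^ (-(3 / 2 : ℝ)) := Real.rpow_pos_of_pos ht0 _
  obtain ⟨-, hp2, hp3⟩ := rpow_bookkeeping ht0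
  have hl0 : 0 ≤ (m : ℝ) / t := by positivity
  have hl1 : (m : ℝ) / t ≤ 1 := (div_le_one ht0).2 hmt
  have hcore := srwHeatKernel_sub_gauss_core ht m hl0 hl1
  have eexp : -((m : ℝ) / t * m) + 7 / 8 * t * ((m : ℝ) / t) ^ 2 = -(u / 8) := by
    rw [hu]; field_simp; ring
  have elam : ((m : ℝ) / t) ^ 4 * t ^ (1 / 2 : ℝ) = u ^ 2 * t ^ (-(3 / 2 : ℝ)) := by
    rw [hp3, ← hp2, hu]; field_simp
  rw [eexp, mul_assoc (8 * Real.exp 5 * π ^ 2), elam] at hcore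
  have hbr : (16 * Real.exp 5 * π ^ 6 + 2) * t ^ (-(3 / 2 : ℝ)) + 8 * Real.exp 5 * π ^ 2 * (u ^ 2 * t ^ (-(3 / 2 : ℝ))) ≤
      K * (1 + u) ^ 2 * t ^ (-(3 / 2 : ℝ)) := by
    have e : K * (1 + u) ^ 2 * t ^ (-(3 / 2 : ℝ)) =
        (16 * Real.exp 5 * π ^ 6 + 2) * ((1 + u) ^ 2 * t ^ (-(3 / 2 : ℝ))) +
          8 * Real.exp 5 * π ^ 2 * ((1 + u) ^ 2 * t ^ (-(3 / 2 : ℝ))) := by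
      rw [hKdef]; ring
    rw [e]
    apply add_le_add
    · refine mul_le_mul_of_nonneg_left ?_ (by positivity)
      calc t ^ (-(3 / 2 : ℝ)) = 1 * t ^ (-(3 / 2 : ℝ)) := (one_mul _).symm
        _ ≤ (1 + u) ^ 2 * t ^ (-(3 / 2 : ℝ)) := by
            refine mul_le_mul_of_nonneg_right ?_ ht32.le
            nlinarith
    · refine mul_le_mul_of_nonneg_left (mul_le_mul_of_nonneg_right ?_ ht32.le) (by positivity)
      exact pow_le_pow_left₀ hu0 (by linarith) 2
  have hw2 := one_add_pow_mul_exp_neg_le (p + 2) hu0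
  calc 2 * π * |srwHeatKernel t m - gaussHeatKernel t m| * (1 + u) ^ p
      ≤ Real.exp (-(u / 8)) * ((16 * Real.exp 5 * π ^ 6 + 2) * t ^ (-(3 / 2 : ℝ)) +
          8 * Real.exp 5 * π ^ 2 * (u ^ 2 * t ^ (-(3 / 2 : ℝ)))) * (1 + u) ^ p :=
        mul_le_mul_of_nonneg_right hcore hw.le
    _ ≤ Real.exp (-(u / 8)) * (K * (1 + u) ^ 2 * t ^ (-(3 / 2 : ℝ))) * (1 + u) ^ p := by
        gcongr
    _ = K * ((1 + u) ^ (p + 2) * Real.exp (-(u / 8))) * t ^ (-(3 / 2 : ℝ)) := by ring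
    _ ≤ K * (8 ^ (p + 2) * (p + 2).factorial * Real.exp (1 / 8)) * t ^ (-(3 / 2 : ℝ)) := by
        gcongr

/-- The Poisson regime `m > t ≥ 1` (`λ = 1`): `2π|q_t(m) - φ_t(m)|(1 + m²/t)^p ≤
K 2^{p+1}8^{2(p+1)}(2(p+1))! t^{-3/2}`. [folklore] -/
theorem lclt_poisson_regime (p : ℕ) {t : ℝ} (ht : 1 ≤ t) {m : ℤ} (hmt : t < (m : ℝ)) :
    2 * π * |srwHeatKernel t m - gaussHeatKernel t m| * (1 + (m : ℝ) ^ 2 / t) ^ p ≤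
      (16 * Real.exp 5 * π ^ 6 + 2 + 8 * Real.exp 5 * π ^ 2) *
        (2 ^ (p + 1) * 8 ^ (2 * (p + 1)) * (2 * (p + 1)).factorial) * t ^ (-(3 / 2 : ℝ)) := by
  set K : ℝ := (16 * Real.exp 5 * π ^ 6 + 2 + 8 * Real.exp 5 * π ^ 2) with hKdef
  have ht0 : 0 < t := by linarith
  have hK : 0 < K := by rw [hKdef]; positivity
  have hm1 : (1 : ℝ) ≤ m := by linarith
  set u : ℝ := (m : ℝ) ^ 2 / t with hu
  have hu0 : 0 ≤ u := by positivity
  have hw : 0 < (1 + u) ^ p := by positivity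
  have ht32 : 0 < t ^ (-(3 / 2 : ℝ)) := Real.rpow_pos_of_pos ht0 _
  obtain ⟨-, hp2, hp3⟩ := rpow_bookkeeping ht0
  have hcore := srwHeatKernel_sub_gauss_core ht m zero_le_one le_rfl
  have hexp : Real.exp (-(1 * (m : ℝ)) + 7 / 8 * t * 1 ^ 2) ≤ Real.exp (-((m : ℝ) / 8)) := by
    rw [Real.exp_le_exp]; nlinarith
  have ht12 : t ^ (-(3 / 2 : ℝ)) ≤ t ^ (1 / 2 : ℝ) :=
    Real.rpow_le_rpow_of_exponent_le ht (by norm_num)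
  have ht12pos : 0 < t ^ (1 / 2 : ℝ) := Real.rpow_pos_of_pos ht0 _
  have hbr : (16 * Real.exp 5 * π ^ 6 + 2) * t ^ (-(3 / 2 : ℝ)) + 8 * Real.exp 5 * π ^ 2 * 1 ^ 4 * t ^ (1 / 2 : ℝ) ≤
      K * t ^ (1 / 2 : ℝ) := by
    have e : K * t ^ (1 / 2 : ℝ) =
        (16 * Real.exp 5 * π ^ 6 + 2) * t ^ (1 / 2 : ℝ) + 8 * Real.exp 5 * π ^ 2 * t ^ (1 / 2 : ℝ) := by
      rw [hKdef]; ring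
    rw [one_pow, mul_one, e]
    exact add_le_add (mul_le_mul_of_nonneg_left ht12 (by positivity)) le_rfl
  have hup : (1 + u) ^ p ≤ (1 + (m : ℝ) ^ 2) ^ p := by
    apply pow_le_pow_left₀ (by positivity)
    refine add_le_add le_rfl ?_
    rw [hu]
    exact div_le_self (by positivity) ht
  have ht2 : t ^ (1 / 2 : ℝ) = t ^ (-(3 / 2 : ℝ)) * t ^ 2 := by
    rw [hp3, ← hp2]; field_simp
  have htm : t ^ 2 ≤ 1 + (m : ℝ) ^ 2 := by nlinarith
  have hw2 := one_add_sq_pow_mul_exp_neg_le (p + 1) hm1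
  calc 2 * π * |srwHeatKernel t m - gaussHeatKernel t m| * (1 + u) ^ p
      ≤ Real.exp (-(1 * (m : ℝ)) + 7 / 8 * t * 1 ^ 2) *
          ((16 * Real.exp 5 * π ^ 6 + 2) * t ^ (-(3 / 2 : ℝ)) + 8 * Real.exp 5 * π ^ 2 * 1 ^ 4 * t ^ (1 / 2 : ℝ)) *
          (1 + u) ^ p := mul_le_mul_of_nonneg_right hcore hw.le
    _ ≤ Real.exp (-((m : ℝ) / 8)) * (K * t ^ (1 / 2 : ℝ)) * (1 + (m : ℝ) ^ 2) ^ p := by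
        gcongr
    _ = Real.exp (-((m : ℝ) / 8)) * K * t ^ (-(3 / 2 : ℝ)) * (t ^ 2 * (1 + (m : ℝ) ^ 2) ^ p) := by
        rw [ht2]; ring
    _ ≤ Real.exp (-((m : ℝ) / 8)) * K * t ^ (-(3 / 2 : ℝ)) * ((1 + (m : ℝ) ^ 2) * (1 + (m : ℝ) ^ 2) ^ p) := by
        gcongr
    _ = K * ((1 + (m : ℝ) ^ 2) ^ (p + 1) * Real.exp (-((m : ℝ) / 8))) * t ^ (-(3 / 2 : ℝ)) := by ring
    _ ≤ K * (2 ^ (p + 1) * 8 ^ (2 * (p + 1)) * (2 * (p + 1)).factorial) * t ^ (-(3 / 2 : ℝ)) := by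
        gcongr

/-- **Gaussian-weighted local central limit theorem for the continuous-time simple random walk on
`ℤ`**: for every `p : ℕ` there is `B > 0` with
`|q_t(m) - (2πt)^{-1/2}e^{-m²/2t}| ≤ B t^{-3/2} (1 + m²/t)^{-p}` for all `t ≥ 1`, `m ∈ ℤ` — the core
comparison with `λ = |m|/t` for `|m| ≤ t` and `λ = 1` for `|m| > t`, the exponential weights traded
for polynomial ones (a continuous-time, Gaussian-weighted form of the local central limit
theorem error estimates of Lawler–Limic 2010, §2.3; proved here from scratch). [folklore] -/
theorem srwHeatKernel_lclt (p : ℕ) : ∃ B : ℝ, 0 < B ∧ ∀ t : ℝ, 1 ≤ t → ∀ m : ℤ,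
    |srwHeatKernel t m - gaussHeatKernel t m| ≤
      B * t ^ (-(3 / 2 : ℝ)) * ((1 + (m : ℝ) ^ 2 / t) ^ p)⁻¹ := by
  set K : ℝ := (16 * Real.exp 5 * π ^ 6 + 2 + 8 * Real.exp 5 * π ^ 2) with hKdef
  have hK : 0 < K := by rw [hKdef]; positivity
  set BA : ℝ := K * (8 ^ (p + 2) * (p + 2).factorial * Real.exp (1 / 8)) / (2 * π) with hBA
  set BB : ℝ := K * (2 ^ (p + 1) * 8 ^ (2 * (p + 1)) * (2 * (p + 1)).factorial) / (2 * π) with hBB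
  have hπ := Real.pi_pos
  have hBA0 : 0 < BA := by positivity
  have hBB0 : 0 < BB := by positivity
  refine ⟨max BA BB, lt_max_of_lt_left hBA0, ?_⟩
  -- reduce to `m ≥ 0`
  suffices H : ∀ t : ℝ, 1 ≤ t → ∀ m : ℤ, 0 ≤ m → |srwHeatKernel t m - gaussHeatKernel t m| ≤
      max BA BB * t ^ (-(3 / 2 : ℝ)) * ((1 + (m : ℝ) ^ 2 / t) ^ p)⁻¹ by
    intro t ht m
    rcases le_or_gt 0 m with hm | hm
    · exact H t ht m hm
    · have h := H t ht (-m) (by omega)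
      rw [srwHeatKernel_neg] at h
      have e : ((-m : ℤ) : ℝ) = -(m : ℝ) := by push_cast; ring
      rw [e, gaussHeatKernel_neg] at h
      simpa using h
  intro t ht m hm
  have ht0 : 0 < t := by linarith
  have hw : 0 < (1 + (m : ℝ) ^ 2 / t) ^ p := by positivity
  have h2π : 0 < 2 * π := by positivity
  rw [← div_eq_mul_inv, le_div_iff₀ hw]
  -- bound `2π |q - φ| (1+u)^p` in the two regimes
  have H : 2 * π * |srwHeatKernel t m - gaussHeatKernel t m| * (1 + (m : ℝ) ^ 2 / t) ^ p ≤
      2 * π * (max BA BB) * t ^ (-(3 / 2 : ℝ)) := by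
    rcases le_or_gt (m : ℝ) t with hmt | hmt
    · calc _ ≤ K * (8 ^ (p + 2) * (p + 2).factorial * Real.exp (1 / 8)) * t ^ (-(3 / 2 : ℝ)) :=
            lclt_gaussian_regime p ht hm hmt
        _ = 2 * π * BA * t ^ (-(3 / 2 : ℝ)) := by rw [hBA]; field_simp
        _ ≤ 2 * π * max BA BB * t ^ (-(3 / 2 : ℝ)) := by gcongr; exact le_max_left _ _
    · calc _ ≤ K * (2 ^ (p + 1) * 8 ^ (2 * (p + 1)) * (2 * (p + 1)).factorial) * t ^ (-(3 / 2 : ℝ)) :=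
            lclt_poisson_regime p ht hmt
        _ = 2 * π * BB * t ^ (-(3 / 2 : ℝ)) := by rw [hBB]; field_simp
        _ ≤ 2 * π * max BA BB * t ^ (-(3 / 2 : ℝ)) := by gcongr; exact le_max_right _ _
  have := div_le_div_of_nonneg_right H h2π.le
  rw [show 2 * π * |srwHeatKernel t m - gaussHeatKernel t m| * (1 + (m : ℝ) ^ 2 / t) ^ p / (2 * π) =
      |srwHeatKernel t m - gaussHeatKernel t m| * (1 + (m : ℝ) ^ 2 / t) ^ p by field_simp,
    show 2 * π * max BA BB * t ^ (-(3 / 2 : ℝ)) / (2 * π) = max BA BB * t ^ (-(3 / 2 : ℝ)) by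
      field_simp] at this
  exact this

/-- A uniform bound on the Gaussian kernel with the same weights: for every `p : ℕ`,
`φ_t(m) ≤ (2^p p! e^{1/2}) t^{-1/2} (1 + m²/t)^{-p}` for `t > 0` and all real `m`. [folklore] -/
theorem gaussHeatKernel_le_weight (p : ℕ) {t : ℝ} (ht : 0 < t) (m : ℝ) :
    gaussHeatKernel t m ≤ (2 ^ p * p.factorial * Real.exp (1 / 2)) * t ^ (-(1 / 2 : ℝ)) * ((1 + m ^ 2 / t) ^ p)⁻¹ := by
  set u : ℝ := m ^ 2 / t with hu
  have hu0 : 0 ≤ u := by positivity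
  have hw : 0 < (1 + u) ^ p := by positivity
  rw [← div_eq_mul_inv, le_div_iff₀ hw]
  -- `(1+u)^p e^{-u/2} ≤ 2^p p! e^{1/2}`
  have hy : 0 ≤ (1 + u) / 2 := by positivity
  have h := Real.pow_div_factorial_le_exp (hx := hy) (n := p)
  have hf : (0 : ℝ) < p.factorial := by exact_mod_cast Nat.factorial_pos p
  rw [div_le_iff₀ hf] at h
  have hkey : (1 + u) ^ p * Real.exp (-(u / 2)) ≤ 2 ^ p * p.factorial * Real.exp (1 / 2) := by
    have e1 : (1 + u) ^ p = 2 ^ p * ((1 + u) / 2) ^ p := by rw [← mul_pow]; congr 1; ring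
    have e2 : Real.exp ((1 + u) / 2) = Real.exp (1 / 2) * Real.exp (u / 2) := by
      rw [← Real.exp_add]; congr 1; ring
    have e3 : Real.exp (u / 2) * Real.exp (-(u / 2)) = 1 := by rw [← Real.exp_add]; simp
    rw [e1]
    calc 2 ^ p * ((1 + u) / 2) ^ p * Real.exp (-(u / 2))
        ≤ 2 ^ p * (Real.exp ((1 + u) / 2) * p.factorial) * Real.exp (-(u / 2)) := by gcongr
      _ = 2 ^ p * p.factorial * Real.exp (1 / 2) * (Real.exp (u / 2) * Real.exp (-(u / 2))) := by
          rw [e2]; ring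
      _ = 2 ^ p * p.factorial * Real.exp (1 / 2) := by rw [e3, mul_one]
  -- `1/√(2πt) ≤ t^{-1/2}`
  have hsqrt : (Real.sqrt (2 * π * t))⁻¹ ≤ t ^ (-(1 / 2 : ℝ)) := by
    rw [Real.rpow_neg ht.le, ← Real.sqrt_eq_rpow]
    refine inv_anti₀ (Real.sqrt_pos.2 ht) (Real.sqrt_le_sqrt ?_)
    have : (1 : ℝ) ≤ 2 * π := by linarith [Real.pi_gt_three]
    nlinarith
  have hmu : -(m ^ 2 / (2 * t)) = -(u / 2) := by rw [hu]; field_simp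
  unfold gaussHeatKernel
  rw [hmu, div_eq_mul_inv]
  calc Real.exp (-(u / 2)) * (Real.sqrt (2 * π * t))⁻¹ * (1 + u) ^ p
      ≤ Real.exp (-(u / 2)) * t ^ (-(1 / 2 : ℝ)) * (1 + u) ^ p := by gcongr
    _ = (1 + u) ^ p * Real.exp (-(u / 2)) * t ^ (-(1 / 2 : ℝ)) := by ring
    _ ≤ 2 ^ p * p.factorial * Real.exp (1 / 2) * t ^ (-(1 / 2 : ℝ)) :=
        mul_le_mul_of_nonneg_right hkey (Real.rpow_nonneg ht.le _)

end Literature.Probability.LatticeModels
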